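import Mathlib
import HarnessLib
import Summits.ValiantsHypothesis.ValiantsHypothesis.Theorems.ValuativeGCTTailFlipStubBoundaryTwistScalar
import Summits.ValiantsHypothesis.ValiantsHypothesis.Theorems.ValuativeGCTTailFlipStubScalarTwistInheritance
import Summits.ValiantsHypothesis.ValiantsHypothesis.Theorems.ValuativeGCTValuativeFlipRayStability

/-!
# `ValuativeGCT.TailFlip` (stmt-ValiantsHypothesis-15687), line `boundary-ray-collapse`:
# boundary padding invariance from a PADDED base, at every padding

Helper file `--supports stmt-ValiantsHypothesis-15687` (lead a1 of the line).  Letters: inner (permanent)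
size `n`, padded base level `m₀ > n`, padding `j`, degree `δ`,
`P_{n,m}(λ) := mult_{λ*} ℂ[Δ_m(X₀₀^{m-n} per_n)] = orbitMultiplicity ℂ (paddedPerFormLex ℂ n m) m (partitionWeightLex m λ)`.

* `boundaryPaddingInvariance` — the LEVER of the line (the planner's former registered stub
  `stub_boundaryPaddingInvariance`, skeleton `Cruxes/TailFlip/Lines/boundary_ray_collapse.lean`): for a
  Kadish–Landsberg BOUNDARY shape `λ ⊢ m₀δ` of `(n, m₀)` (at most `m₀²` parts, first row EXACTLY
  `λ₁ = δ(m₀ - n)`) and every padding `j`,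
  `P_{n,m₀}(λ) ≤ P_{n,m₀+j}(λ♯(m₀+j))` — the padded-permanent multiplicity is non-decreasing along the
  boundary ray from the PADDED base, with NO exceptional padding.  It is the composition of the two landed
  stubs of the line: `stub_boundaryTwistScalar` (at boundary weight BIP's padding twist `Δ_j` acts on every
  highest-weight vector at every column-normalised point as the scalar `((m₀-n+j).descFactorial j)^δ`) and
  `stub_scalarTwistInheritance` (a nonzero scalar twist transports the full untwisted certificate of size
  `P_{n,m₀}(λ)` to level `m₀ + j`).
* `boundaryPaddingInvariance_mono` — the same along the ray between two paddings `j₁ ≤ j₂`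
  (the row-lift of a boundary shape is again boundary).

Contrast (landed): from a padded base, single padding steps FAIL for general shapes
(`Theorems.ValuativeFlip.padding_step_monotonicity_fails`); from the UNPADDED base `m₀ = n` every padding
inherits (`perAnchorInheritance_every`), but those rays are row-lift rays, never boundary rays.

Sources: Kadish–Landsberg, Commun. Algebra 42 (2014) §2 (arXiv:1204.4693); BLMW, SIAM J. Comput. 40 (2011)
§6.4 Problem 6.10; Bürgisser–Ikenmeyer–Panova, J. AMS 32 (2019) Lemma 5.2–5.3, Thm 5.4 (arXiv numbering);
Ikenmeyer–Panova, Adv. Math. 319 (2017) Prop. 2.6(b).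
-/

set_option linter.dupNamespace false

namespace Summit.ValiantsHypothesis.ValiantsHypothesis.Theorems.TailFlip

open MvPolynomial
open scoped BigOperators Matrix
open Literature.NumberTheory.DiophantineGeometry
open Literature.Computability.AlgebraicComplexity
open Literature.Computability.Complexity
open Summit.ValiantsHypothesis.ValiantsHypothesis.Theorems.ValuativeFlip

noncomputable section

/-- **Boundary padding invariance from a padded base, every padding** (the lever of line
`boundary-ray-collapse`; formerly the registered stub `stub_boundaryPaddingInvariance`).  For `n < m₀`,
every padding `j`, and every Kadish–Landsberg boundary shape `λ ⊢ m₀·δ` of `(n, m₀)` (at most `m₀²`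
parts, first row exactly `δ(m₀ - n)`):
`mult_{λ*} ℂ[Δ_{m₀}(X₀₀^{m₀-n} per_n)] ≤ mult_{(λ♯(m₀+j))*} ℂ[Δ_{m₀+j}(X₀₀^{m₀+j-n} per_n)]`.
Proof: `stub_scalarTwistInheritance` with the scalar `((m₀-n+j).descFactorial j)^δ ≠ 0`
(`Nat.descFactorial_eq_zero_iff_lt`: `j ≤ m₀ - n + j`) supplied by `stub_boundaryTwistScalar`.
[Kadish–Landsberg 2014 §2; BLMW 2011 Problem 6.10; Bürgisser–Ikenmeyer–Panova 2019 §5; new] -/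
theorem boundaryPaddingInvariance : ∀ (n m₀ j δ : ℕ) [NeZero m₀] [NeZero (m₀ + j)], n < m₀ → ∀ (lam : Nat.Partition (m₀ * δ)), lam.parts.card ≤ m₀ * m₀ → lam.parts.sup = δ * (m₀ - n) → orbitMultiplicity ℂ (paddedPerFormLex ℂ n m₀) m₀ (partitionWeightLex m₀ lam) ≤ orbitMultiplicity ℂ (paddedPerFormLex ℂ n (m₀ + j)) (m₀ + j) (partitionWeightLex (m₀ + j) (rowLift lam j)) := by
  intro n m₀ j δ _ _ hnm lam hlam hsup
  have hs : ((((m₀ - n + j).descFactorial j : ℕ) : ℂ) ^ δ) ≠ 0 := by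
    refine pow_ne_zero _ (Nat.cast_ne_zero.mpr ?_)
    exact (Nat.descFactorial_eq_zero_iff_lt.not).mpr (by omega)
  exact stub_scalarTwistInheritance n m₀ j δ hnm lam hlam _ hs
    (fun F hF A hA => stub_boundaryTwistScalar n m₀ j δ hnm lam hlam hsup F hF A hA)

/-- The row-lift of a boundary shape of `(n, m₀)` is a boundary shape of `(n, m₀ + j)`:
`(λ♯(m₀+j))₁ = λ₁ + jδ = δ(m₀ + j - n)` for `λ₁ = δ(m₀ - n)`, `n < m₀`. [folklore] -/
theorem sup_parts_rowLift_of_boundary {n m₀ δ : ℕ} (hnm : n < m₀) (lam : Nat.Partition (m₀ * δ))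
    (hsup : lam.parts.sup = δ * (m₀ - n)) (j : ℕ) :
    (rowLift lam j).parts.sup = δ * (m₀ + j - n) := by
  rw [sup_parts_rowLift, hsup]
  have h1 : m₀ + j - n = (m₀ - n) + j := by omega
  rw [h1, Nat.mul_add, Nat.mul_comm j δ]

/-- **Monotonicity along the boundary ray between two paddings.**  For a boundary shape `λ` of
`(n, m₀)` and `j₁ ≤ j₂`: `P_{n,m₀+j₁}(λ♯(m₀+j₁)) ≤ P_{n,m₀+j₂}(λ♯(m₀+j₂))` (apply
`boundaryPaddingInvariance` at the padded base `m₀ + j₁`, whose shape `λ♯(m₀+j₁)` is again boundary,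
and transport `(λ♯(m₀+j₁))♯ = λ♯(m₀+j₂)` by `parts_rowLift_rowLift` and the level/parts congruence
`orbitMultiplicity_paddedPer_congr_level`). [new] -/
theorem boundaryPaddingInvariance_mono
    (n m₀ δ : ℕ) [NeZero m₀] (hnm : n < m₀)
    (lam : Nat.Partition (m₀ * δ)) (hlam : lam.parts.card ≤ m₀ * m₀) (hsup : lam.parts.sup = δ * (m₀ - n))
    {j₁ j₂ : ℕ} (hj : j₁ ≤ j₂) [NeZero (m₀ + j₁)] [NeZero (m₀ + j₂)] :
    orbitMultiplicity ℂ (paddedPerFormLex ℂ n (m₀ + j₁)) (m₀ + j₁) (partitionWeightLex (m₀ + j₁) (rowLift lam j₁)) ≤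
      orbitMultiplicity ℂ (paddedPerFormLex ℂ n (m₀ + j₂)) (m₀ + j₂) (partitionWeightLex (m₀ + j₂) (rowLift lam j₂)) := by
  obtain ⟨j, rfl⟩ := Nat.exists_eq_add_of_le hj
  haveI : NeZero (m₀ + j₁ + j) := ⟨by have := NeZero.ne m₀; omega⟩
  have h1 := boundaryPaddingInvariance n (m₀ + j₁) j δ (by omega) (rowLift lam j₁)
    (card_parts_rowLift_le_sq lam hlam j₁) (sup_parts_rowLift_of_boundary hnm lam hsup j₁)
  rwa [orbitMultiplicity_paddedPer_congr_level (m₂ := m₀ + (j₁ + j)) (Nat.add_assoc m₀ j₁ j)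
    (rowLift (rowLift lam j₁) j) (rowLift lam (j₁ + j)) (parts_rowLift_rowLift lam j₁ j)] at h1

end

end Summit.ValiantsHypothesis.ValiantsHypothesis.Theorems.TailFlip
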